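import Summits.AnomalousDissipation.AnomalousDissipation.Theorems.SolenoidalFractalHomogenisationLagrangianCarrierConstructionRegularLFlow
import Summits.AnomalousDissipation.AnomalousDissipation.Theorems.SolenoidalFractalHomogenisationLagrangianCarrierConstructionTowerStepA
import Summits.AnomalousDissipation.AnomalousDissipation.Theorems.SolenoidalFractalHomogenisationLagrangianCarrierConstructionOneDirectional
import HarnessLib

/-!
# K3L `LagrangianCarrierConstruction` (stmt-AnomalousDissipation-24913), line `birth`, stub `stub_regularL`: UNIQUENESS of the Lagrangian
# insertion — `IsLagrangian` pins the level fields and displacements (helper; `--supports stmt-AnomalousDissipation-24913`)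

Summits-side helper file (everything proved; no definitions, no named facts). Second brick towards `stub_regularL` (skeleton r23 v6): two
Lagrangian lattice carriers with the same bookkeeping and the same refresh windows which both satisfy `IsLagrangian` and the qualitative
clauses (L1), (L3a), (L3b), (F1a) of `LevelRegular` have the SAME level fields `b (m+1)` and the SAME displacements `disp m` for every
`m` (`isLagrangian_unique`). Induction on the level: equal coarse fields have equal lifted partial sums, so (integral form `IsFlow` +
ODE uniqueness, `…RegularLFlow.repr_add_disp_eq_evolutionMap`) equal displacements, equal flow maps and flow derivatives, and the coarse
flow maps are onto (they are evolution maps of lattice-periodic Lipschitz fields read on the torus), so `IsInserted` pins the next level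
everywhere. Consequence for `stub_regularL`: the abstract carrier of its hypotheses IS the Lagrangian tower of
`…FlowsLRegular.exists_isLagrangian_levelRegular'`, so every property proved for the tower transfers. Infrastructure for route-1's rung leaf
F-D1.A0 (a frontier FORMAL rung); NOT a proof of anomalous dissipation.
-/

set_option linter.dupNamespace false

noncomputable section

namespace Summit.AnomalousDissipation.AnomalousDissipation.Theorems.SolenoidalFractalHomogenisation.LagrangianCarrierConstruction

open Set Function Filter Topology MeasureTheory
open scoped NNReal ContDiff
open Literature.Analysis Literature.Analysis.ODE Literature.Analysis.FunctionSpaces Literature.Analysis.FunctionSpaces.Torus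
open Literature.Analysis.FluidPDE Literature.Analysis.FluidPDE.LatticeShear

variable {k : ℕ}

/-- The lifted partial sums are lattice periodic in space. [folklore] -/
theorem partialSum_proj_add_latticeVec (E : LagrangianLatticeCarrier k) (m : ℕ) (t : ℝ) (z : EuclideanSpace ℝ (Fin 3))
    (n : Fin 3 → ℤ) : E.partialSum m t (proj (z + latticeVec n)) = E.partialSum m t (proj z) := by
  rw [proj_add_latticeVec]

/-- Under the identification of the displacements with evolution maps, every coarse flow map `X m t s` is ONTO. [folklore] -/
theorem surjective_X_of_regular (E : LagrangianLatticeCarrier k) (m : ℕ) (hflow : E.IsFlow m)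
    (h1 : ∀ m, Continuous (uncurry (E.b (m + 1)))) (h3a : ∀ m t, IsSmooth (E.b (m + 1) t))
    (h3b : ∀ m (n : ℕ), ∃ C : ℝ, ∀ t y, ‖iteratedFDeriv ℝ n (Torus.lift (E.b (m + 1) t)) y‖ ≤ C)
    (hF1a : ∀ m s, Continuous fun p : ℝ × UnitAddTorus (Fin 3) => E.disp m p.1 s p.2) (t s : ℝ) :
    Surjective (E.X m t s) := by
  intro x
  have hB := isUniformlyLipschitzOn_partialSum_proj E h1 h3a h3b m
  have hper := partialSum_proj_add_latticeVec E m
  refine ⟨proj (evolutionMap (fun t (z : EuclideanSpace ℝ (Fin 3)) => E.partialSum m t (proj z)) t s (repr x)), ?_⟩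
  have h := repr_add_disp_eq_evolutionMap E m hflow h1 h3a h3b hF1a t s
    (proj (evolutionMap (fun t (z : EuclideanSpace ℝ (Fin 3)) => E.partialSum m t (proj z)) t s (repr x)))
  obtain ⟨n, hn⟩ := exists_repr_proj_eq_add_latticeVec_holds
    (evolutionMap (fun t (z : EuclideanSpace ℝ (Fin 3)) => E.partialSum m t (proj z)) t s (repr x))
  unfold LagrangianLatticeCarrier.X
  calc proj (evolutionMap (fun t (z : EuclideanSpace ℝ (Fin 3)) => E.partialSum m t (proj z)) t s (repr x)) +
        proj (E.disp m t s (proj (evolutionMap (fun t (z : EuclideanSpace ℝ (Fin 3)) => E.partialSum m t (proj z)) t s (repr x))))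
      = proj (repr (proj (evolutionMap (fun t (z : EuclideanSpace ℝ (Fin 3)) => E.partialSum m t (proj z)) t s (repr x))) +
          E.disp m t s (proj (evolutionMap (fun t (z : EuclideanSpace ℝ (Fin 3)) => E.partialSum m t (proj z)) t s (repr x)))) := by
        rw [proj_add, proj_repr]
    _ = x := by
        rw [h, hn, evolutionMap_add_latticeVec hB hper s t, proj_add_latticeVec,
          hB.evolutionMap_symm convex_univ (mem_univ t) (mem_univ s), proj_repr]

/-- **Uniqueness of the Lagrangian insertion.** Two carriers over the same bookkeeping with the same refresh windows, both `IsLagrangian`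
and both satisfying (L1), (L3a), (L3b), (F1a), have the same level fields `b (m+1)` and the same displacements `disp m`.
[cite: ArmstrongVicol2025, §2.2 (PDF p. 18: the iterative construction b_m = b_{m−1} + Σ_l 𝟙 v_m(t, X_{m−1}^{-1}), X_m the flow of b_{≤m})] -/
theorem isLagrangian_unique (E E' : LagrangianLatticeCarrier k) (hdata : E'.toFractalCarrierData = E.toFractalCarrierData)
    (hR : E'.refresh = E.refresh) (hL : E.IsLagrangian) (hL' : E'.IsLagrangian)
    (h1 : ∀ m, Continuous (uncurry (E.b (m + 1)))) (h3a : ∀ m t, IsSmooth (E.b (m + 1) t))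
    (h3b : ∀ m (n : ℕ), ∃ C : ℝ, ∀ t y, ‖iteratedFDeriv ℝ n (Torus.lift (E.b (m + 1) t)) y‖ ≤ C)
    (hF1a : ∀ m s, Continuous fun p : ℝ × UnitAddTorus (Fin 3) => E.disp m p.1 s p.2)
    (h1' : ∀ m, Continuous (uncurry (E'.b (m + 1)))) (h3a' : ∀ m t, IsSmooth (E'.b (m + 1) t))
    (h3b' : ∀ m (n : ℕ), ∃ C : ℝ, ∀ t y, ‖iteratedFDeriv ℝ n (Torus.lift (E'.b (m + 1) t)) y‖ ≤ C)
    (hF1a' : ∀ m s, Continuous fun p : ℝ × UnitAddTorus (Fin 3) => E'.disp m p.1 s p.2) :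
    (∀ m, E'.b (m + 1) = E.b (m + 1)) ∧ ∀ m, E'.disp m = E.disp m := by
  -- strong induction: the levels `1, …, m` agree ⇒ the displacements `disp m` agree ⇒ level `m+1` agrees
  have step : ∀ m, (∀ i, i < m → E'.b (i + 1) = E.b (i + 1)) → E'.disp m = E.disp m ∧ E'.b (m + 1) = E.b (m + 1) := by
    intro m ih
    have hPS : E'.partialSum m = E.partialSum m := by
      funext t x
      unfold LagrangianLatticeCarrier.partialSum
      exact Finset.sum_congr rfl fun i hi => by rw [ih i (Finset.mem_range.mp hi)]
    have hdisp : E'.disp m = E.disp m := by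
      funext t s x
      have h := repr_add_disp_eq_evolutionMap E m (hL m).1 h1 h3a h3b hF1a t s x
      have h' := repr_add_disp_eq_evolutionMap E' m (hL' m).1 h1' h3a' h3b' hF1a' t s x
      rw [hPS] at h'
      exact add_left_cancel (h'.trans h.symm)
    refine ⟨hdisp, ?_⟩
    funext t x
    obtain ⟨j, hj⟩ : ∃ j : ℤ, t ∈ E.window (m + 1) j := ⟨_, mem_window_floor E (m + 1) t⟩
    have hj' : t ∈ E'.window (m + 1) j := by unfold LagrangianLatticeCarrier.window; rw [hR]; exact hj
    obtain ⟨y, hy⟩ := surjective_X_of_regular E m (hL m).1 h1 h3a h3b hF1a t ((j : ℝ) * E.refresh (m + 1)) x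
    have hX : E'.X m t ((j : ℝ) * E'.refresh (m + 1)) y = E.X m t ((j : ℝ) * E.refresh (m + 1)) y := by
      unfold LagrangianLatticeCarrier.X; rw [hR, hdisp]
    have hD : E'.flowDeriv m t ((j : ℝ) * E'.refresh (m + 1)) y = E.flowDeriv m t ((j : ℝ) * E.refresh (m + 1)) y := by
      unfold LagrangianLatticeCarrier.flowDeriv; rw [hR, hdisp]
    have h := (hL' m).2 j t hj' y
    rw [hX, hy, hD, hdata] at h
    rw [h, ← (hL m).2 j t hj y, hy]
  have H : ∀ n, ∀ i, i < n → E'.b (i + 1) = E.b (i + 1) := by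
    intro n
    induction n with
    | zero => intro i hi; exact absurd hi (Nat.not_lt_zero i)
    | succ n ih =>
      intro i hi
      rcases Nat.lt_succ_iff_lt_or_eq.mp hi with hi' | rfl
      · exact ih i hi'
      · exact (step i ih).2
  exact ⟨fun m => H (m + 1) m (Nat.lt_succ_self m), fun m => (step m fun i _ => H (i + 1) i (Nat.lt_succ_self i)).1⟩

end Summit.AnomalousDissipation.AnomalousDissipation.Theorems.SolenoidalFractalHomogenisation.LagrangianCarrierConstruction

end
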